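import Summits.QuantumFields.YangMills.Theses.CertificationLength

/-!
# Birth skeleton (BC3) for crux `CompleteAnalyticityAtLargeScales` (stmt-QuantumFields-16178) — `Lines/birth.lean`

Registrar: `planner-skel-stmt-QuantumFields-16178-0` (skeleton-register one-shot; route
`route-QuantumFields-CertificationLength`, re-audit bin REPAIRABLE), 2026-08-17.  Line card: `Lines/birth.md`.

Crux (route file `Theses/CertificationLength.lean`, decl
`Summit.QuantumFields.YangMills.Theses.CertificationLength.CompleteAnalyticityAtLargeScales`, rank 2, item (A)):
for every compact simple `G` and faithful unitary lattice representation `r` there are `n ≥ 1`, `ε ≥ 0` with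
`ε · M(n) < 1`, `M(n) = (4n+3)⁴ − (4n+1)⁴`, such that FOR EVERY `B : ℕ` there is `β₂` with: for every `β ≥ β₂`
SOME cell size `b ≥ max(B, 1)` satisfies the total-variation finite-size condition `FS(r.ρ, β, b, n, ε)` of the
PROVED engine `OneCertifiedCube.FiniteSizeCriterion` (stmt-QuantumFields-8895) verbatim (every `[b,2b]`-frame `w`,
every cell union `Y ∋ 0` of the `(4n+1)⁴`-cell cube, every two exteriors agreeing on the cube, every `[0,1]`-valued
measurable cylinder function `f` of the central cell: the two `γ_Y`-expectations of `f` differ by `≤ ε`).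

## The cut = the route's own remark under support `CertificationLengthDiverges`

> "Hence every certifying scale → ∞ and the scheme-free form `∀ β ≥ β₁ ∃ b ≥ 1 certified` already implies (A)."

The crux is "Dobrushin–Shlosman certifiability at all large couplings" `∧` "at arbitrarily large scales".  The
skeleton separates exactly these two:

* `stub_certifiedAtSomeScale` — **CertifiedAtSomeScale, the open core (complete analyticity of the 4-d Wilson
  theory deep in weak coupling, at SOME scale)**: for every compact simple `G` and faithful `r` there are admissible
  `(n, ε)` and ONE threshold `β₁` such that for every `β ≥ β₁` SOME cell size `b ≥ 1` is certified,
  `FS(r.ρ, β, b, n, ε)`.  It is the crux with the clause `B ≤ b` deleted (crux ⇒ stub: `example` below, `B := 1`),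
  i.e. strictly the `B`-free part; all of the mass-gap / strong-mixing physics lives here (intended proof, route
  TWO-LAYER PLAN: clustering at rate `m(β)` ⇒ screened exterior influence ⇒ certificate at `b ≍ 1/m(β)`).
  Why it might fail: verbatim the crux's risk — the TV sup over ALL exterior fields is strictly stronger than a gap
  (weak ⇏ strong mixing in `d ≥ 3`, Shlosman 1986); near a bulk first-order point no scale certifies.
* `stub_noCertificateAtBoundedScale` — **NoCertificateAtBoundedScale (elementary criticality of the certificate)**:
  for every compact SIMPLE `G`, faithful `r`, admissible `(n, ε)` and bound `B` there is `β₂` such that for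
  `β ≥ β₂` NO cell size `1 ≤ b ≤ B` is certified.  Mechanism (Laplace / flux conservation): on the fixed finite
  region the conditional Wilson laws concentrate as `β → ∞` on exterior-steered action minimisers; an exterior
  carrying a small abelian flux `θ ≍ R⁻²` (`R = (4n+1)·2B` sites) forces, by the `mod 2π` plaquette-angle sum rule
  on every `(1,2)`-slice of the touching region (whose boundary loop consists of FROZEN links only), total flux
  `θ R²` through the slice, spread evenly by convexity, so the central cell's plaquette angle is `≍ θ` under one
  exterior and `0` under the trivial one while fluctuations are `O(β^{-1/2})`: the two central-cell laws of a
  side-`≥ 2` central cell become TV-disjoint, influence → 1 > ε.  This is the route's support item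
  `CertificationLengthDiverges` (stmt-QuantumFields-16181) RESTRICTED to compact simple `G` (support ⇒ stub:
  `example` below).  The restriction is deliberate: 16181 as filed has no `IsCompactSimpleLieGroup G` binder and is
  false for the trivial group (`LGConfig 4 Unit` is a singleton, every influence is `0`, `FS` holds at every
  `(β, b)`), so the stub must not inherit that witness; the crux only ever needs the simple case.
  Why it might fail: only through a typing artefact of `FS` (e.g. if cylinder functions of a side-`b` cell saw no
  closed plaquette — they do for side `≥ 2`, and `[b, 2b]`-frames always contain side-`2b ≥ 2` cells); the
  physics (unscreened abelian flux at scales `≪ ξ(β)`) is perturbative and robust.  Size M.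
* `CompleteAnalyticityAtLargeScales_of` — the composition, sorry-free: take `(n, ε, β₁)` from Stub 1; given `B`
  take `β₂(B)` from Stub 2 and the threshold `max β₁ β₂`; the certified `b ≥ 1` of Stub 1 cannot be `≤ B` by
  Stub 2, hence `B ≤ b`.  Registered form uses the stubs BY NAME (no hypotheses, as `#h21_check_skeleton`
  requires); the `example` after it is the same glue with the two stub STATEMENTS as hypotheses.

Hardest stub: `stub_certifiedAtSomeScale` (difficulty = the crux's, open-problem).  Honest accounting: the cut
does not make the core easier, it isolates it from the scale bookkeeping and pins the one genuinely provable-now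
piece (Stub 2, M-sized) that turns "some scale" into "arbitrarily large scales".

## Disproof used

* No `Cruxes/CompleteAnalyticityAtLargeScales/Disproof.lean` exists (no standing disprover on this crux; `ledger
  crux ls stmt-QuantumFields-16178`: no workfiles before this one); no `Theorems/CompleteAnalyticityAtLargeScales/
  Negative/*` lemma has landed; `ledger negatives --problem QuantumFields` lists no statement about the finite-size
  condition at fixed coupling.  Junk audit (refuter rreview-0816T16-4 note on the item): at `β = 0` certificates
  are free (product Haar), irrelevant to both stubs (large `β` only); under the stubs' hypotheses `r.ρ` is
  continuous, so the Wilson kernels are probability measures and `FS` is a genuine TV statement; every evaluable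
  Wilson model (trivial or finite `G`) fails `IsCompactSimpleLieGroup`, so neither stub has a degenerate inhabitant
  or a cheap refutation in the tree.

## Audit (registrar folder `bc/`)

`lean check --json`: rc 0, sorries = 2 = stubs (`stub_certifiedAtSomeScale`, `stub_noCertificateAtBoundedScale`),
zero elsewhere; `CompleteAnalyticityAtLargeScales_of` concludes
`Summit.QuantumFields.YangMills.Theses.CertificationLength.CompleteAnalyticityAtLargeScales` BY NAME.  BC3 probes
(`bc/probe_*.lean`, importing only the route file + a verbatim copy of the stub statement as a `def`):
`stub → CompleteAnalyticityAtLargeScales` and `stub → YangMills` by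
`first | exact? | simpa | simpa [Stub] | (unfold Stub; simpa) | aesop` FAIL 4/4 (details in `Lines/birth.md`).
Namespace `Summit.QuantumFields.YangMills.Cruxes.CompleteAnalyticityAtLargeScales.Birth`.
-/

namespace Summit.QuantumFields.YangMills.Cruxes.CompleteAnalyticityAtLargeScales.Birth

open MeasureTheory Filter Topology
open Literature.MathematicalPhysics.QuantumFieldTheory
open Literature.MathematicalPhysics.QuantumLattice
open Literature.MathematicalPhysics.AQFT

/-- **Stub 1 — `CertifiedAtSomeScale` (the open core).** For every compact simple `G` and faithful unitary lattice
representation `r` there are `n ≥ 1`, `ε ≥ 0` with `ε · ((4n+3)⁴ − (4n+1)⁴) < 1` and a threshold `β₁` such that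
for every `β ≥ β₁` SOME cell size `b ≥ 1` satisfies the TV finite-size condition of `FiniteSizeCriterion` verbatim
— Wilson's 4-d lattice theory is Dobrushin–Shlosman certifiable, at some scale, at every large coupling.  (The crux
with its clause `B ≤ b` removed.) -/
theorem stub_certifiedAtSomeScale :
    ∀ (G : Type) [Group G] [TopologicalSpace G] [IsTopologicalGroup G] [CompactSpace G],
      IsCompactSimpleLieGroup G → letI : MeasurableSpace G := borel G; haveI : BorelSpace G := ⟨rfl⟩;
      ∀ r : LatticeRep G, ∃ (n : ℕ) (ε : ℝ), 1 ≤ n ∧ 0 ≤ ε ∧ ε * ((((4 * n + 3) ^ 4 - (4 * n + 1) ^ 4 : ℕ)) : ℝ) < 1 ∧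
        ∃ β₁ : ℝ, ∀ β : ℝ, β₁ ≤ β → ∃ b : ℕ, 1 ≤ b ∧
          (∀ w : Fin 4 → ℤ → ℤ, (∀ i j, w i j + ((b : ℕ) : ℤ) ≤ w i (j + 1) ∧ w i (j + 1) ≤ w i j + 2 * ((b : ℕ) : ℤ)) → ∀ Y : Finset (Fin 4 → ℤ), Y ⊆ (Fintype.piFinset fun _ : Fin 4 => Finset.Icc (-(2 * ((n : ℕ) : ℤ))) (2 * ((n : ℕ) : ℤ))) → (0 : Fin 4 → ℤ) ∈ Y → ∀ η η' : LGConfig 4 G, (∀ e ∈ (Fintype.piFinset fun _ : Fin 4 => Finset.Icc (-(2 * ((n : ℕ) : ℤ))) (2 * ((n : ℕ) : ℤ))).biUnion (fun y : Fin 4 → ℤ => (Fintype.piFinset fun i : Fin 4 => Finset.Ico (w i (y i)) (w i (y i + 1))) ×ˢ (Finset.univ : Finset (Fin 4))), η e = η' e) → ∀ f : LGConfig 4 G → ℝ, IsCylinder f ((fun y : Fin 4 → ℤ => (Fintype.piFinset fun i : Fin 4 => Finset.Ico (w i (y i)) (w i (y i + 1))) ×ˢ (Finset.univ : Finset (Fin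 4))) 0) → Measurable f → (∀ U, 0 ≤ f U ∧ f U ≤ 1) → |(∫ U, f U ∂(ymSpecification r.ρ β (Y.biUnion (fun y : Fin 4 → ℤ => (Fintype.piFinset fun i : Fin 4 => Finset.Ico (w i (y i)) (w i (y i + 1))) ×ˢ (Finset.univ : Finset (Fin 4)))) η)) - ∫ U, f U ∂(ymSpecification r.ρ β (Y.biUnion (fun y : Fin 4 → ℤ => (Fintype.piFinset fun i : Fin 4 => Finset.Ico (w i (y i)) (w i (y i + 1))) ×ˢ (Finset.univ : Finset (Fin 4)))) η')| ≤ ε) := by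
  sorry

/-- **Stub 2 — `NoCertificateAtBoundedScale` (elementary criticality of the certificate).** For every compact
SIMPLE `G`, faithful `r` and admissible `(n, ε)`: for every `B` there is `β₂` such that for `β ≥ β₂` NO cell size
`1 ≤ b ≤ B` satisfies the TV finite-size condition (Laplace concentration on exterior-steered minimisers; a small
abelian flux outside the cube, unscreened at scales `≪ ξ(β)`, moves the central cell's plaquette law to TV-distance
→ 1).  This is the route's support `CertificationLengthDiverges` (stmt-QuantumFields-16181) restricted to compact
simple `G` (the unrestricted item is false for the trivial group). -/
theorem stub_noCertificateAtBoundedScale :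
    ∀ (G : Type) [Group G] [TopologicalSpace G] [IsTopologicalGroup G] [CompactSpace G],
      IsCompactSimpleLieGroup G → letI : MeasurableSpace G := borel G; haveI : BorelSpace G := ⟨rfl⟩;
      ∀ (r : LatticeRep G) (n : ℕ) (ε : ℝ), 1 ≤ n → 0 ≤ ε → ε * ((((4 * n + 3) ^ 4 - (4 * n + 1) ^ 4 : ℕ)) : ℝ) < 1 →
        ∀ B : ℕ, ∃ β₂ : ℝ, ∀ β : ℝ, β₂ ≤ β → ∀ b : ℕ, 1 ≤ b → b ≤ B →
          ¬ (∀ w : Fin 4 → ℤ → ℤ, (∀ i j, w i j + ((b : ℕ) : ℤ) ≤ w i (j + 1) ∧ w i (j + 1) ≤ w i j + 2 * ((b : ℕ) : ℤ)) → ∀ Y : Finset (Fin 4 → ℤ), Y ⊆ (Fintype.piFinset fun _ : Fin 4 => Finset.Icc (-(2 * ((n : ℕ) : ℤ))) (2 * ((n : ℕ) : ℤ))) → (0 : Fin 4 → ℤ) ∈ Y → ∀ η η' : LGConfig 4 G, (∀ e ∈ (Fintype.piFinset fun _ : Fin 4 => Finset.Icc (-(2 * ((n : ℕ) : ℤ)))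 (2 * ((n : ℕ) : ℤ))).biUnion (fun y : Fin 4 → ℤ => (Fintype.piFinset fun i : Fin 4 => Finset.Ico (w i (y i)) (w i (y i + 1))) ×ˢ (Finset.univ : Finset (Fin 4))), η e = η' e) → ∀ f : LGConfig 4 G → ℝ, IsCylinder f ((fun y : Fin 4 → ℤ => (Fintype.piFinset fun i : Fin 4 => Finset.Ico (w i (y i)) (w i (y i + 1))) ×ˢ (Finset.univ : Finset (Fin 4))) 0) → Measurable f → (∀ U, 0 ≤ f U ∧ f U ≤ 1) → |(∫ U, f U ∂(ymSpecification r.ρ β (Y.biUnion (fun y : Fin 4 → ℤ => (Fintype.piFinset fun i : Fin 4 => Finset.Ico (w i (y i)) (w i (y i + 1))) ×ˢ (Finset.univ : Finset (Fin 4)))) η)) - ∫ U, f U ∂(ymSpecification r.ρ β (Y.biUnion (fun y : Fin 4 → ℤ => (Fintype.piFinset fun i : Fin 4 => Finset.Ico (w i (y i)) (w i (y i + 1))) ×ˢ (Finset.univ : Finset (Fin 4)))) η')| ≤ ε) := by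
  sorry

/-- **Composition** — the crux BY NAME from the two stubs BY NAME: `(n, ε, β₁)` from Stub 1; for a given `B` the
threshold `max β₁ (β₂ B)` with `β₂` from Stub 2; the certified `b ≥ 1` delivered by Stub 1 is not `≤ B` by Stub 2,
hence `B ≤ b`.  Registered form (no hypotheses); the `example` right after it is the same glue with the two stub
STATEMENTS as explicit hypotheses and no reference to the stubs. -/
theorem CompleteAnalyticityAtLargeScales_of :
    Summit.QuantumFields.YangMills.Theses.CertificationLength.CompleteAnalyticityAtLargeScales := by
  intro G _ _ _ _ hG
  letI : MeasurableSpace G := borel G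
  haveI : BorelSpace G := ⟨rfl⟩
  intro r
  obtain ⟨n, ε, hn, hε, hM, β₁, hcert⟩ := stub_certifiedAtSomeScale G hG r
  refine ⟨n, ε, hn, hε, hM, fun B => ?_⟩
  obtain ⟨β₂, hnone⟩ := stub_noCertificateAtBoundedScale G hG r n ε hn hε hM B
  refine ⟨max β₁ β₂, fun β hβ => ?_⟩
  obtain ⟨b, hb1, hFS⟩ := hcert β (le_trans (le_max_left _ _) hβ)
  refine ⟨b, ?_, hb1, hFS⟩
  by_contra hBb
  exact hnone β (le_trans (le_max_right _ _) hβ) b hb1 (le_of_lt (not_le.mp hBb)) hFS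

/-- **The glue alone, sorry-free, hypothesis form**: Stub 1's statement → Stub 2's statement → the crux (verbatim
signatures; this `example` does not mention the stubs, so any `sorry` here would be flagged — there is none). -/
example
    (h₁ : ∀ (G : Type) [Group G] [TopologicalSpace G] [IsTopologicalGroup G] [CompactSpace G],
      IsCompactSimpleLieGroup G → letI : MeasurableSpace G := borel G; haveI : BorelSpace G := ⟨rfl⟩;
      ∀ r : LatticeRep G, ∃ (n : ℕ) (ε : ℝ), 1 ≤ n ∧ 0 ≤ ε ∧ ε * ((((4 * n + 3) ^ 4 - (4 * n + 1) ^ 4 : ℕ)) : ℝ) < 1 ∧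
      ∃ β₁ : ℝ, ∀ β : ℝ, β₁ ≤ β → ∃ b : ℕ, 1 ≤ b ∧
      (∀ w : Fin 4 → ℤ → ℤ, (∀ i j, w i j + ((b : ℕ) : ℤ) ≤ w i (j + 1) ∧ w i (j + 1) ≤ w i j + 2 * ((b : ℕ) : ℤ)) → ∀ Y : Finset (Fin 4 → ℤ), Y ⊆ (Fintype.piFinset fun _ : Fin 4 => Finset.Icc (-(2 * ((n : ℕ) : ℤ))) (2 * ((n : ℕ) : ℤ))) → (0 : Fin 4 → ℤ) ∈ Y → ∀ η η' : LGConfig 4 G, (∀ e ∈ (Fintype.piFinset fun _ : Fin 4 => Finset.Icc (-(2 * ((n : ℕ) : ℤ))) (2 * ((n : ℕ) : ℤ))).biUnion (fun y : Fin 4 → ℤ => (Fintype.piFinset fun i : Fin 4 => Finset.Ico (w i (y i)) (w i (y i + 1))) ×ˢ (Finset.univ : Finset (Fin 4))), η e = η' e) → ∀ f : LGConfig 4 G → ℝ, IsCylinder f ((fun y : Fin 4 → ℤ => (Fintype.piFinset fun i : Fin 4 => Finset.Ico (w i (y i)) (w i (y i + 1))) ×ˢ (Finset.univ : Finset (Fin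 4))) 0) → Measurable f → (∀ U, 0 ≤ f U ∧ f U ≤ 1) → |(∫ U, f U ∂(ymSpecification r.ρ β (Y.biUnion (fun y : Fin 4 → ℤ => (Fintype.piFinset fun i : Fin 4 => Finset.Ico (w i (y i)) (w i (y i + 1))) ×ˢ (Finset.univ : Finset (Fin 4)))) η)) - ∫ U, f U ∂(ymSpecification r.ρ β (Y.biUnion (fun y : Fin 4 → ℤ => (Fintype.piFinset fun i : Fin 4 => Finset.Ico (w i (y i)) (w i (y i + 1))) ×ˢ (Finset.univ : Finset (Fin 4)))) η')| ≤ ε))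
    (h₂ : ∀ (G : Type) [Group G] [TopologicalSpace G] [IsTopologicalGroup G] [CompactSpace G],
      IsCompactSimpleLieGroup G → letI : MeasurableSpace G := borel G; haveI : BorelSpace G := ⟨rfl⟩;
      ∀ (r : LatticeRep G) (n : ℕ) (ε : ℝ), 1 ≤ n → 0 ≤ ε → ε * ((((4 * n + 3) ^ 4 - (4 * n + 1) ^ 4 : ℕ)) : ℝ) < 1 →
      ∀ B : ℕ, ∃ β₂ : ℝ, ∀ β : ℝ, β₂ ≤ β → ∀ b : ℕ, 1 ≤ b → b ≤ B →
      ¬ (∀ w : Fin 4 → ℤ → ℤ, (∀ i j, w i j + ((b : ℕ) : ℤ) ≤ w i (j + 1) ∧ w i (j + 1) ≤ w i j + 2 * ((b : ℕ) : ℤ)) → ∀ Y : Finset (Fin 4 → ℤ), Y ⊆ (Fintype.piFinset fun _ : Fin 4 => Finset.Icc (-(2 * ((n : ℕ) : ℤ))) (2 * ((n : ℕ) : ℤ))) → (0 : Fin 4 → ℤ) ∈ Y → ∀ η η' : LGConfig 4 G, (∀ e ∈ (Fintype.piFinset fun _ : Fin 4 => Finset.Icc (-(2 * ((n : ℕ)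 : ℤ))) (2 * ((n : ℕ) : ℤ))).biUnion (fun y : Fin 4 → ℤ => (Fintype.piFinset fun i : Fin 4 => Finset.Ico (w i (y i)) (w i (y i + 1))) ×ˢ (Finset.univ : Finset (Fin 4))), η e = η' e) → ∀ f : LGConfig 4 G → ℝ, IsCylinder f ((fun y : Fin 4 → ℤ => (Fintype.piFinset fun i : Fin 4 => Finset.Ico (w i (y i)) (w i (y i + 1))) ×ˢ (Finset.univ : Finset (Fin 4))) 0) → Measurable f → (∀ U, 0 ≤ f U ∧ f U ≤ 1) → |(∫ U, f U ∂(ymSpecification r.ρ β (Y.biUnion (fun y : Fin 4 → ℤ => (Fintype.piFinset fun i : Fin 4 => Finset.Ico (w i (y i)) (w i (y i + 1))) ×ˢ (Finset.univ : Finset (Fin 4)))) η)) - ∫ U, f U ∂(ymSpecification r.ρ β (Y.biUnion (fun y : Fin 4 → ℤ => (Fintype.piFinset fun i : Fin 4 => Finset.Ico (w i (y i)) (w i (y i + 1))) ×ˢ (Finset.univ : Finset (Fin 4)))) η')| ≤ ε)) :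
    Summit.QuantumFields.YangMills.Theses.CertificationLength.CompleteAnalyticityAtLargeScales := by
  intro G _ _ _ _ hG
  letI : MeasurableSpace G := borel G
  haveI : BorelSpace G := ⟨rfl⟩
  intro r
  obtain ⟨n, ε, hn, hε, hM, β₁, hcert⟩ := h₁ G hG r
  refine ⟨n, ε, hn, hε, hM, fun B => ?_⟩
  obtain ⟨β₂, hnone⟩ := h₂ G hG r n ε hn hε hM B
  refine ⟨max β₁ β₂, fun β hβ => ?_⟩
  obtain ⟨b, hb1, hFS⟩ := hcert β (le_trans (le_max_left _ _) hβ)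
  refine ⟨b, ?_, hb1, hFS⟩
  by_contra hBb
  exact hnone β (le_trans (le_max_right _ _) hβ) b hb1 (le_of_lt (not_le.mp hBb)) hFS

/-- Signature match (kernel-checked): the composition inhabits the crux decl by name. -/
example : Summit.QuantumFields.YangMills.Theses.CertificationLength.CompleteAnalyticityAtLargeScales :=
  CompleteAnalyticityAtLargeScales_of

/-- Crux ⇒ Stub 1's statement (the easy direction, recorded so the cut is visibly a WEAKENING on the scale side:
instantiate the crux at `B := 1`). -/
example (h : Summit.QuantumFields.YangMills.Theses.CertificationLength.CompleteAnalyticityAtLargeScales) :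
    ∀ (G : Type) [Group G] [TopologicalSpace G] [IsTopologicalGroup G] [CompactSpace G],
      IsCompactSimpleLieGroup G → letI : MeasurableSpace G := borel G; haveI : BorelSpace G := ⟨rfl⟩;
      ∀ r : LatticeRep G, ∃ (n : ℕ) (ε : ℝ), 1 ≤ n ∧ 0 ≤ ε ∧ ε * ((((4 * n + 3) ^ 4 - (4 * n + 1) ^ 4 : ℕ)) : ℝ) < 1 ∧
        ∃ β₁ : ℝ, ∀ β : ℝ, β₁ ≤ β → ∃ b : ℕ, 1 ≤ b ∧
          (∀ w : Fin 4 → ℤ → ℤ, (∀ i j, w i j + ((b : ℕ) : ℤ) ≤ w i (j + 1) ∧ w i (j + 1) ≤ w i j + 2 * ((b : ℕ) : ℤ)) → ∀ Y : Finset (Fin 4 → ℤ), Y ⊆ (Fintype.piFinset fun _ : Fin 4 => Finset.Icc (-(2 * ((n : ℕ) : ℤ))) (2 * ((n : ℕ) : ℤ))) → (0 : Fin 4 → ℤ) ∈ Y → ∀ η η' : LGConfig 4 G, (∀ e ∈ (Fintype.piFinset fun _ : Fin 4 => Finset.Icc (-(2 * ((n : ℕ) : ℤ))) (2 * ((n :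 ℕ) : ℤ))).biUnion (fun y : Fin 4 → ℤ => (Fintype.piFinset fun i : Fin 4 => Finset.Ico (w i (y i)) (w i (y i + 1))) ×ˢ (Finset.univ : Finset (Fin 4))), η e = η' e) → ∀ f : LGConfig 4 G → ℝ, IsCylinder f ((fun y : Fin 4 → ℤ => (Fintype.piFinset fun i : Fin 4 => Finset.Ico (w i (y i)) (w i (y i + 1))) ×ˢ (Finset.univ : Finset (Fin 4))) 0) → Measurable f → (∀ U, 0 ≤ f U ∧ f U ≤ 1) → |(∫ U, f U ∂(ymSpecification r.ρ β (Y.biUnion (fun y : Fin 4 → ℤ => (Fintype.piFinset fun i : Fin 4 => Finset.Ico (w i (y i)) (w i (y i + 1))) ×ˢ (Finset.univ : Finset (Fin 4)))) η)) - ∫ U, f U ∂(ymSpecification r.ρ β (Y.biUnion (fun y : Fin 4 → ℤ => (Fintype.piFinset fun i : Fin 4 => Finset.Ico (w i (y i)) (w i (y i + 1))) ×ˢ (Finset.univ : Finset (Fin 4)))) η')| ≤ ε) := by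
  intro G _ _ _ _ hG
  letI : MeasurableSpace G := borel G
  haveI : BorelSpace G := ⟨rfl⟩
  intro r
  obtain ⟨n, ε, hn, hε, hM, hB⟩ := h G hG r
  obtain ⟨β₂, h₂⟩ := hB 1
  refine ⟨n, ε, hn, hε, hM, β₂, fun β hβ => ?_⟩
  obtain ⟨b, -, hb1, hFS⟩ := h₂ β hβ
  exact ⟨b, hb1, hFS⟩

/-- The route's support item `CertificationLengthDiverges` (stmt-QuantumFields-16181, stated for ALL compact `G`)
⇒ Stub 2's statement (its restriction to compact simple `G`): a proof of 16181 closes Stub 2, not conversely. -/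
example (h : Summit.QuantumFields.YangMills.Theses.CertificationLength.CertificationLengthDiverges) :
    ∀ (G : Type) [Group G] [TopologicalSpace G] [IsTopologicalGroup G] [CompactSpace G],
      IsCompactSimpleLieGroup G → letI : MeasurableSpace G := borel G; haveI : BorelSpace G := ⟨rfl⟩;
      ∀ (r : LatticeRep G) (n : ℕ) (ε : ℝ), 1 ≤ n → 0 ≤ ε → ε * ((((4 * n + 3) ^ 4 - (4 * n + 1) ^ 4 : ℕ)) : ℝ) < 1 →
        ∀ B : ℕ, ∃ β₂ : ℝ, ∀ β : ℝ, β₂ ≤ β → ∀ b : ℕ, 1 ≤ b → b ≤ B →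
          ¬ (∀ w : Fin 4 → ℤ → ℤ, (∀ i j, w i j + ((b : ℕ) : ℤ) ≤ w i (j + 1) ∧ w i (j + 1) ≤ w i j + 2 * ((b : ℕ) : ℤ)) → ∀ Y : Finset (Fin 4 → ℤ), Y ⊆ (Fintype.piFinset fun _ : Fin 4 => Finset.Icc (-(2 * ((n : ℕ) : ℤ))) (2 * ((n : ℕ) : ℤ))) → (0 : Fin 4 → ℤ) ∈ Y → ∀ η η' : LGConfig 4 G, (∀ e ∈ (Fintype.piFinset fun _ : Fin 4 => Finset.Icc (-(2 * ((n : ℕ) : ℤ))) (2 * ((n : ℕ) : ℤ))).biUnion (fun y : Fin 4 → ℤ => (Fintype.piFinset fun i : Fin 4 => Finset.Ico (w i (y i)) (w i (y i + 1))) ×ˢ (Finset.univ : Finset (Fin 4))), η e = η' e) → ∀ f : LGConfig 4 G → ℝ, IsCylinder f ((fun y : Fin 4 → ℤ => (Fintype.piFinset fun i : Fin 4 => Finset.Ico (w i (y i)) (w i (y i + 1))) ×ˢ (Finset.univ : Finset (Fin 4))) 0) → Measurable f → (∀ U, 0 ≤ f U ∧ f U ≤ 1) → |(∫ U, f U ∂(ymSpecification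 r.ρ β (Y.biUnion (fun y : Fin 4 → ℤ => (Fintype.piFinset fun i : Fin 4 => Finset.Ico (w i (y i)) (w i (y i + 1))) ×ˢ (Finset.univ : Finset (Fin 4)))) η)) - ∫ U, f U ∂(ymSpecification r.ρ β (Y.biUnion (fun y : Fin 4 → ℤ => (Fintype.piFinset fun i : Fin 4 => Finset.Ico (w i (y i)) (w i (y i + 1))) ×ˢ (Finset.univ : Finset (Fin 4)))) η')| ≤ ε) := by
  intro G _ _ _ _ _
  exact h G

end Summit.QuantumFields.YangMills.Cruxes.CompleteAnalyticityAtLargeScales.Birth
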